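import Summits.ResolutionOfSingularities.ResolutionOfSingularities.Theses.RadicialJung
import Summits.ResolutionOfSingularities.ResolutionOfSingularities.Theorems.RadicialJungCleanModelsReduction
import HarnessLib

/-!
# Route `RadicialJung`, crux `CleanModels` (stmt-ResolutionOfSingularities-15917): the reduction to log-clean
# principalization, POINTWISE IN `W` (and hence dimension-graded)

`Theorems.RadicialJung.CleanModels.cleanModels_of_logCleanPrincipalization` (landed, `RadicialJungCleanModelsReduction.lean`)
reduces the crux to LOOSE log-clean principalization of one `g₀ ∈ K(W) ∖ K(W)^p`, but only as an implication between the
two ALL-DIMENSION statements.  Its proof is pointwise in `W`; this file records the pointwise form, so that every SLICE of the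
crux (the registered stubs `stub_cleanModelsDimThree`, `stub_cleanModelsDimGEFour` of the dimension cut
`Cruxes/CleanModels/Lines/Sketch.lean` rev 11 / `Cruxes/DescentPerfectToAll/Lines/via_clean_models.lean` rev 3) reduces to
loose log-clean principalization in the SAME dimension range:

* `cleanModelsAt_of_logCleanPrincipalizationAt` — for FIXED `(p, k, W, L)`: loose log-clean principalization of every
  `g₀ ∈ K(W) ∖ K(W)^p` on `W` ⟹ the conclusion of `CleanModels` for `(W, L)`;
* `cleanModelsDimThree_of_logCleanPrincipalizationDimThree` — the dim-3 slice (`¬ dim W ≤ 2 ∧ dim W ≤ 3`) of the crux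
  follows from loose log-clean principalization on regular 3-folds (the target of plan P2 of the card
  `Cruxes/DescentPerfectToAll/Lines/via-clean-models.md`: Cossart–Piltant 2019 Thm 1.5 (i) in the (S,h,E)-frame + the
  monogenic cleanness lemma `clean_of_monogenic_regular` + patching for clean pairs).

Bookkeeping only (lead `res-B-lead-1` g0, 2026-08-28); nothing here proves resolution in characteristic `p`, and
`CleanModels` in `dim ≥ 3` remains unsettled.
-/

noncomputable section

set_option linter.dupNamespace false -- mandated namespace of this single-conjunct summit

open CategoryTheory AlgebraicGeometry TopologicalSpace
open Literature.AlgebraicGeometry.Resolution Literature.AlgebraicGeometry.Motives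

namespace Summit.ResolutionOfSingularities.ResolutionOfSingularities.Theorems.RadicialJung.CleanModels

/-- **The crux reduces to log-clean principalization, pointwise in `W`.**  Fix a prime `p`, a field `k` of
characteristic `p`, a regular integral `W` separated of finite type over `k` and a purely inseparable `L/K(W)` of degree
`p`.  If every `g₀ ∈ K(W) ∖ K(W)^p` admits a proper birational regular `V → W` on which some non-trivial representative
`Σ_{j<p} c_j^p g₀^j` of its `K(W)^p`-line is LOOSELY clean at every point, then `(W, L)` has an exactly log-clean model
(the conclusion of `CleanModels`).  Same bookkeeping as `cleanModels_of_logCleanPrincipalization` (generator `y₀`,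
pointwise normalisation `x ↦ ε^p x + δ`, transport of `ε` along `π^♯ : K(W) ≅ K(V)`, Frobenius twist). [folklore] -/
theorem cleanModelsAt_of_logCleanPrincipalizationAt (p : ℕ) (hp : p.Prime) (k : Type) [Field k] [CharP k p]
    (W : Scheme.{0}) [IsIntegral W] (f : W ⟶ Spec (.of k)) (L : Type) [Field L]
    [Algebra W.functionField L] [IsSeparated f] [LocallyOfFiniteType f]
    [QuasiCompact f] (hPI : IsPurelyInseparable W.functionField L)
    (hdeg : Module.finrank W.functionField L = p)
    (h : ∀ g₀ : W.functionField, (∀ c : W.functionField, c ^ p ≠ g₀) →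
      ∃ (V : Scheme.{0}) (π : V ⟶ W) (_ : IsIntegral V) (_ : IsDominant π),
        IsProper π ∧ IsBirational π ∧ Scheme.IsRegular V ∧
        ∀ v : V, ∃ c : Fin p → W.functionField, (∃ j : Fin p, (j : ℕ) ≠ 0 ∧ c j ≠ 0) ∧
          ((∃ (d m : ℕ) (hmd : m ≤ d) (t : Fin d → V.presheaf.stalk v) (a : Fin m → ℕ)
              (u : V.presheaf.stalk v), IsUnit u ∧
              Ideal.span (Set.range t) = IsLocalRing.maximalIdeal (V.presheaf.stalk v) ∧
              ringKrullDim (V.presheaf.stalk v) = (d : WithBot ℕ∞) ∧ 0 < m ∧ (∀ i, ¬ p ∣ a i) ∧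
              RatFn.functionFieldMap π (∑ j : Fin p, c j ^ p * g₀ ^ (j : ℕ)) =
                algebraMap (V.presheaf.stalk v) V.functionField
                  (u * ∏ i : Fin m, t (Fin.castLE hmd i) ^ (a i))) ∨
            (∃ u : V.presheaf.stalk v, IsUnit u ∧
              RatFn.functionFieldMap π (∑ j : Fin p, c j ^ p * g₀ ^ (j : ℕ)) =
                algebraMap (V.presheaf.stalk v) V.functionField u ∧
              ∀ c' : V.presheaf.stalk v,
                u - c' ^ p ∉ IsLocalRing.maximalIdeal (V.presheaf.stalk v)) ∨
            (∃ s c' : V.presheaf.stalk v,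
              RatFn.functionFieldMap π (∑ j : Fin p, c j ^ p * g₀ ^ (j : ℕ)) =
                algebraMap (V.presheaf.stalk v) V.functionField s ∧
              s - c' ^ p ∈ IsLocalRing.maximalIdeal (V.presheaf.stalk v) ∧
              s - c' ^ p ∉ IsLocalRing.maximalIdeal (V.presheaf.stalk v) ^ 2))) :
    ∃ (V : Scheme.{0}) (π : V ⟶ W) (_ : IsIntegral V) (_ : IsDominant π),
      IsProper π ∧ IsBirational π ∧ Scheme.IsRegular V ∧
      (∀ v : V, (∃ (y : L) (g : W.functionField), y ∉ Set.range (algebraMap W.functionField L) ∧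
        algebraMap W.functionField L g = y ^ p ∧
        ((∃ (d m : ℕ) (hmd : m ≤ d) (t : Fin d → V.presheaf.stalk v) (a : Fin m → ℕ),
            Ideal.span (Set.range t) = IsLocalRing.maximalIdeal (V.presheaf.stalk v) ∧
            ringKrullDim (V.presheaf.stalk v) = (d : WithBot ℕ∞) ∧ 0 < m ∧ (∀ i, ¬ p ∣ a i) ∧
            RatFn.functionFieldMap π g = ∏ i : Fin m,
              (algebraMap (V.presheaf.stalk v) V.functionField (t (Fin.castLE hmd i))) ^ (a i)) ∨
          (∃ u₀ : V.presheaf.stalk v, IsUnit u₀ ∧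
            RatFn.functionFieldMap π g = algebraMap (V.presheaf.stalk v) V.functionField u₀ ∧
            ((∀ c : V.presheaf.stalk v,
                u₀ - c ^ p ∉ IsLocalRing.maximalIdeal (V.presheaf.stalk v)) ∨
              (∃ c : V.presheaf.stalk v,
                u₀ - c ^ p ∈ IsLocalRing.maximalIdeal (V.presheaf.stalk v) ∧
                u₀ - c ^ p ∉ IsLocalRing.maximalIdeal (V.presheaf.stalk v) ^ 2)))))) := by
  haveI := hPI
  haveI : CharP W.functionField p := charP_stalk W f _
  -- a generator of `L/K(W)`
  obtain ⟨-, y₀, g₀, hy₀, hg₀, hg₀p⟩ :=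
    stub_generator (K := W.functionField) (L := L) p hp hdeg
  -- the loosely clean model
  obtain ⟨V, π, hVint, hπdom, hπprop, hπbir, hVreg, hclean⟩ := h g₀ hg₀p
  refine ⟨V, π, hVint, hπdom, hπprop, hπbir, hVreg, fun v => ?_⟩
  obtain ⟨c, ⟨j₀, hj₀, hc⟩, hloose⟩ := hclean v
  haveI : CharP (V.presheaf.stalk v) p := charP_stalk V (π ≫ f) v
  -- normalise the loose form at `v`
  obtain ⟨ε, δ, hε, hδ, hexact⟩ := stub_pointwiseTransfer (O := V.presheaf.stalk v)
    (K := V.functionField) p hp (RatFn.functionFieldMap π (∑ j : Fin p, c j ^ p * g₀ ^ (j : ℕ)))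
    hloose
  -- `π^♯ : K(W) ≅ K(V)`
  have hbij : Function.Bijective (RatFn.functionFieldMap π) := by
    obtain ⟨U, hU, hU', hiso⟩ := hπbir
    haveI := hiso
    exact RatFn.functionFieldMap_bijective_of_isIso_morphismRestrict π U hU hU'
  let e : W.functionField ≃+* V.functionField := RingEquiv.ofBijective _ hbij
  have he : ∀ x, e x = RatFn.functionFieldMap π x := fun _ => rfl
  -- the unit `ε`, read in `K(W)`
  set ε' : W.functionField := e.symm (algebraMap (V.presheaf.stalk v) V.functionField ε) with hε'def
  have heε' : RatFn.functionFieldMap π ε' = algebraMap (V.presheaf.stalk v) V.functionField ε := by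
    rw [← he, hε'def, RingEquiv.apply_symm_apply]
  have hε' : ε' ≠ 0 := by
    intro h0
    have h1 : algebraMap (V.presheaf.stalk v) V.functionField ε = 0 := by
      rw [← heε', h0, map_zero]
    exact (hε.map (algebraMap (V.presheaf.stalk v) V.functionField)).ne_zero h1
  -- the twisted representative is a `p`-th power of an element of `L ∖ K(W)`
  obtain ⟨y, hy, hyp⟩ :=
    stub_frobeniusTwist (K := W.functionField) (L := L) p hp y₀ g₀ hy₀ hg₀ c j₀ hj₀ hc ε' hε' δ hδ
  refine ⟨y, ε' ^ p * (∑ j : Fin p, c j ^ p * g₀ ^ (j : ℕ)) + δ, hy, hyp, ?_⟩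
  have hmap : RatFn.functionFieldMap π (ε' ^ p * (∑ j : Fin p, c j ^ p * g₀ ^ (j : ℕ)) + δ) =
      algebraMap (V.presheaf.stalk v) V.functionField ε ^ p *
        RatFn.functionFieldMap π (∑ j : Fin p, c j ^ p * g₀ ^ (j : ℕ)) + δ := by
    rw [map_add, map_mul, map_pow, heε', map_natCast]
  rw [hmap]
  exact hexact
/-- **The dim-3 slice of the crux follows from loose log-clean principalization on regular 3-folds** — the registered
stub `stub_cleanModelsDimThree` (skeletons `Cruxes/CleanModels/Lines/Sketch.lean` rev 11 and, before G1,
`Cruxes/DescentPerfectToAll/Lines/via_clean_models.lean` rev 2) in terms of the P2 target. [folklore] -/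
theorem cleanModelsDimThree_of_logCleanPrincipalizationDimThree
    (h3 : ∀ (p : ℕ), p.Prime → ∀ (k : Type) [Field k] [CharP k p] (W : Scheme.{0}) [IsIntegral W]
      (f : W ⟶ Spec (.of k)) [IsSeparated f] [LocallyOfFiniteType f] [QuasiCompact f],
      Scheme.IsRegular W → ¬ topologicalKrullDim W ≤ 2 → topologicalKrullDim W ≤ 3 →
      ∀ g₀ : W.functionField, (∀ c : W.functionField, c ^ p ≠ g₀) →
      ∃ (V : Scheme.{0}) (π : V ⟶ W) (_ : IsIntegral V) (_ : IsDominant π),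
        IsProper π ∧ IsBirational π ∧ Scheme.IsRegular V ∧
        ∀ v : V, ∃ c : Fin p → W.functionField, (∃ j : Fin p, (j : ℕ) ≠ 0 ∧ c j ≠ 0) ∧
          ((∃ (d m : ℕ) (hmd : m ≤ d) (t : Fin d → V.presheaf.stalk v) (a : Fin m → ℕ)
              (u : V.presheaf.stalk v), IsUnit u ∧
              Ideal.span (Set.range t) = IsLocalRing.maximalIdeal (V.presheaf.stalk v) ∧
              ringKrullDim (V.presheaf.stalk v) = (d : WithBot ℕ∞) ∧ 0 < m ∧ (∀ i, ¬ p ∣ a i) ∧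
              RatFn.functionFieldMap π (∑ j : Fin p, c j ^ p * g₀ ^ (j : ℕ)) =
                algebraMap (V.presheaf.stalk v) V.functionField
                  (u * ∏ i : Fin m, t (Fin.castLE hmd i) ^ (a i))) ∨
            (∃ u : V.presheaf.stalk v, IsUnit u ∧
              RatFn.functionFieldMap π (∑ j : Fin p, c j ^ p * g₀ ^ (j : ℕ)) =
                algebraMap (V.presheaf.stalk v) V.functionField u ∧
              ∀ c' : V.presheaf.stalk v,
                u - c' ^ p ∉ IsLocalRing.maximalIdeal (V.presheaf.stalk v)) ∨
            (∃ s c' : V.presheaf.stalk v,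
              RatFn.functionFieldMap π (∑ j : Fin p, c j ^ p * g₀ ^ (j : ℕ)) =
                algebraMap (V.presheaf.stalk v) V.functionField s ∧
              s - c' ^ p ∈ IsLocalRing.maximalIdeal (V.presheaf.stalk v) ∧
              s - c' ^ p ∉ IsLocalRing.maximalIdeal (V.presheaf.stalk v) ^ 2))) :
    ∀ p : ℕ, p.Prime → ∀ (k : Type) [Field k] [CharP k p] (W : AlgebraicGeometry.Scheme.{0}) [AlgebraicGeometry.IsIntegral W] (f : W ⟶ AlgebraicGeometry.Spec (.of k)) (L : Type) [Field L] [Algebra W.functionField L], AlgebraicGeometry.IsSeparated f → AlgebraicGeometry.LocallyOfFiniteType f → AlgebraicGeometry.QuasiCompact f → Literature.AlgebraicGeometry.Resolution.Scheme.IsRegular W → IsPurelyInseparable W.functionField L → Module.finrank W.functionField L = p → ¬ topologicalKrullDim W ≤ 2 → topologicalKrullDim W ≤ 3 → ∃ (V : AlgebraicGeometry.Scheme.{0}) (π : V ⟶ W) (_ : AlgebraicGeometry.IsIntegral V) (_ : AlgebraicGeometry.IsDominant π), AlgebraicGeometry.IsProper π ∧ Literature.AlgebraicGeometry.Resolution.IsBirational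 π ∧ Literature.AlgebraicGeometry.Resolution.Scheme.IsRegular V ∧ (∀ v : V, (∃ (y : L) (g : W.functionField), y ∉ Set.range (algebraMap W.functionField L) ∧ algebraMap W.functionField L g = y ^ p ∧ ((∃ (d m : ℕ) (hmd : m ≤ d) (t : Fin d → V.presheaf.stalk v) (a : Fin m → ℕ), Ideal.span (Set.range t) = IsLocalRing.maximalIdeal (V.presheaf.stalk v) ∧ ringKrullDim (V.presheaf.stalk v) = (d : WithBot ℕ∞) ∧ 0 < m ∧ (∀ i, ¬ p ∣ a i) ∧ Literature.AlgebraicGeometry.Motives.RatFn.functionFieldMap π g = ∏ i : Fin m, (algebraMap (V.presheaf.stalk v) V.functionField (t (Fin.castLE hmd i))) ^ (a i)) ∨ (∃ u₀ : V.presheaf.stalk v, IsUnit u₀ ∧ Literature.AlgebraicGeometry.Motives.RatFn.functionFieldMap π g = algebraMap (V.presheaf.stalk v) V.functionField u₀ ∧ ((∀ c : V.presheaf.stalk v, u₀ - c ^ p ∉ IsLocalRing.maximalIdeal (V.presheaf.stalk v)) ∨ (∃ c : V.presheaf.stalk v, u₀ - c ^ p ∈ IsLocalRing.maximalIdeal (V.presheaf.stalk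 v) ∧ u₀ - c ^ p ∉ IsLocalRing.maximalIdeal (V.presheaf.stalk v) ^ 2)))))) := by
  intro p hp k _ _ W _ f L _ _ hsep hloc hqc hWreg hPI hdeg h2 h3'
  haveI := hsep; haveI := hloc; haveI := hqc
  exact cleanModelsAt_of_logCleanPrincipalizationAt p hp k W f L hPI hdeg
    (fun g₀ hg₀ => h3 p hp k W f hWreg h2 h3' g₀ hg₀)

end Summit.ResolutionOfSingularities.ResolutionOfSingularities.Theorems.RadicialJung.CleanModels

end
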